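/-
Copyright (c) 2026 the pub-hodgecm-mathlib formalisation cell (harness21).  Prover seat hodgecm-mathlib-LH4-p16 (g0), req620 Track A «(D-RAM) FOUR-FRAME» squad
(STAGE-1b, row (2) of the piece `f_{T₊}`, the (β₂) road under heir LEAD F0P3a-plan (g21) T20-18∕T20-19 (R-36) «PURE-CELL LEDGER, RELATIVE SIGNS»; β₂ sub-dealer
LH4-p04 (g8) BETA2-BOARD v1.1 row (L-K0) «the near cell `K₀` against the diagonal cell `D`»), 2026-09-04.
-/
import Summits.HodgeConjecture.HodgeConjecture.Theorems.F0P3cDyRamDiagonalCellCrossLiteral   -- ★ (LH4-p19 (g0)) `finsum_mem_inter_eq_ite_of_label`, `cellDiff_eq_neg_cellDiff_of_opposite_labels`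
import HarnessLib

/-!
# Crux `H413`, line LH4 «(D-RAM) FOUR-FRAME» — STAGE-1b, row (2), the (β₂) road (R-36), row (L-K0) in the `cellDiff` currency: «TWO PURE CELLS WITH PROPORTIONAL WEIGHTS» —
# a pure cell's labelled difference is `±` its weighted size; two pure cells labelled by the SAME proposition `s` with weights in ratio `c` have `cellDiff(K) = c·cellDiff(D)`,
# with OPPOSITE labels `cellDiff(K) = −c·cellDiff(D)`; the relative rows (κ-b) «`K₀ = +D`» (deep) ∕ «`K₀ = −D`» (`δ = 2d`) of the RamM ledger in ONE currency

Cell `hodgecm-mathlib` (D-0151), FLOOR 0, crux item H413 = `stmt-HodgeConjecture-24833`, route of record `HCCMUnconditional`; squad F0∕P3c∕LH4; lane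
`--supports stmt-HodgeConjecture-24833 --as helper` (count-neutral; pays NO tier-0 row).  THEOREMS ONLY (no `def`, no instance, no notation, no `sorry`, default heartbeats);
★-only imports; states NO law; (β₂) stays a HYPOTHESIS.  PURE INDICATOR ALGEBRA over an index type `ι` (the cells are `Set ι`, the weights `ι → ℕ`, the labels `ι → Prop`).

WHY (BETA2-BOARD v1.1 rows (L-K0) ∕ (L-Σ); LH4-cdis1 (g0) 15:32:52Z RamM table (κ-b): «`K₀,ℓ = +D_ℓ` at `δ ≥ 8`», «`K₀,ℓ = −D_ℓ` at `δ = 6`»; ★ p861491 RamM sizes `#K₀ = (q − 1)q^{j−1}`,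
`#D = q^j`; ★ p861810 (this seat) «the letter of a ray-dominated cell is `(f·h_W) • X₊`» — the SAME letter on `D` and `K₀` in the deep regime).  ★ p861637's sibling
`F0P3cDyRamDiagonalCellCrossLiteral` §2 types the `cellDiff` currency of ★ p861305 §3 (`cellDiff_t(C) = Σᶠ_{C ∩ q₊ᵗ} f_t − Σᶠ_{C ∩ q₋ᵗ} f_t` in `ℤ`) for two pure cells of EQUAL
weight and OPPOSITE label.  The near cell needs the PROPORTIONAL version: `K₀` and `D` are both pure, their weighted sizes are in a ratio `c` (RamM: `c = q − 1` at equal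
weight per vertex, ★ p861491), and their labels agree (deep `δ`, ★ p861810: one letter `(f·h_W) • X₊` for both) or disagree (`δ = 2d`, OPEN mechanism).  THIS FILE:
* `cellDiff_eq_ite_of_label` — a PURE cell (`P ↔ s`, `Q ↔ ¬s` on weighted members) has `cellDiff = if s then W else −W`, `W = Σᶠ_C f` its weighted size;
* `cellDiff_eq_mul_cellDiff_of_same_labels` — SAME `s` on `D` and `K`, `W(K) = c·W(D)` ⟹ `cellDiff(K) = c·cellDiff(D)` ((κ-b) deep: `K₀ = (q − 1)·D` per literal);
* `cellDiff_eq_neg_mul_cellDiff_of_opposite_labels` — `K` labelled by `¬s` ⟹ `cellDiff(K) = −(c·cellDiff(D))` ((κ-b) `δ = 2d`; `c = 1` is ★ p861637's sibling's (L-D×));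
* `cellDiff_add_cellDiff_of_same_labels` ∕ `cellDiff_add_cellDiff_of_opposite_labels` — the two-cell subtotal `cellDiff(K) + cellDiff(D) = (c + 1)·cellDiff(D)` ∕ `(1 − c)·cellDiff(D)`
  that (L-Σ) consumes (RamM, `q = 2`, `c = 1`: the `δ = 2d` pair CANCELS).
WHAT IS NOT CLAIMED: which `s` labels which cell (the letters: ★ p861810 ∕ ★ p861637 and LH4-p04 (g8)'s (S4) dictionaries), the sizes (★ p861491), the regime thresholds.
HONEST LABEL.  Count-neutral indicator algebra; nothing printed is asserted; no census law is stated; `HC_CM` is proved only modulo the 7 printed citations (2 remaining named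
inputs: hLiu418 = `stmt-HodgeConjecture-24832`, h413 = `stmt-HodgeConjecture-24833`) until rung 0 closes.
## References
* [Kottwitz1986BaseChangeUnits] R. E. Kottwitz, *Base change for unit elements of Hecke algebras*, Compositio Math. 60 (1986): §1 pp. 240–241 (the labelled lattice count).
* [Rogawski1990] J. D. Rogawski, *Automorphic Representations of Unitary Groups in Three Variables*, Ann. of Math. Stud. 123 (1990): §4.9 Prop. 4.9.1 (b) p. 55.
* [LanglandsShelstad1987] R. P. Langlands, D. Shelstad, *On the definition of transfer factors*, Math. Ann. 278 (1987): §1–§3 (κ-signs on a stable class).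
-/

set_option autoImplicit false

noncomputable section

namespace Summit.HodgeConjecture.HodgeConjecture.Cruxes.H413.F0P3cDyRamNearCellLedger

open Summit.HodgeConjecture.HodgeConjecture.Cruxes.H413.F0P3cDyRamDiagonalCellCrossLiteral (finsum_mem_inter_eq_ite_of_label)

variable {ι : Type*}

/-- **A PURE CELL'S LABELLED DIFFERENCE IS `±` ITS WEIGHTED SIZE**: if one proposition `s` labels every weighted member of `C` (`P Λ ↔ s`, `Q Λ ↔ ¬s` whenever `f Λ ≠ 0`), then
`(Σᶠ_{C ∩ P} f : ℤ) − Σᶠ_{C ∩ Q} f = if s then Σᶠ_C f else −Σᶠ_C f`. [cite: Kottwitz1986BaseChangeUnits, §1 pp. 240–241] [cite: Rogawski1990, §4.9 Prop. 4.9.1 (b) p. 55] -/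
theorem cellDiff_eq_ite_of_label (C : Set ι) (f : ι → ℕ) (P Q : ι → Prop) (s : Prop) [Decidable s]
    (h : ∀ Λ ∈ C, f Λ ≠ 0 → (P Λ ↔ s) ∧ (Q Λ ↔ ¬ s)) :
    ((∑ᶠ Λ ∈ C ∩ {Λ | P Λ}, f Λ : ℕ) : ℤ) - ((∑ᶠ Λ ∈ C ∩ {Λ | Q Λ}, f Λ : ℕ) : ℤ) =
      if s then ((∑ᶠ Λ ∈ C, f Λ : ℕ) : ℤ) else -((∑ᶠ Λ ∈ C, f Λ : ℕ) : ℤ) := by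
  classical
  rw [finsum_mem_inter_eq_ite_of_label C P f s (fun x hx hf => (h x hx hf).1),
    finsum_mem_inter_eq_ite_of_label C Q f (¬ s) (fun x hx hf => (h x hx hf).2)]
  by_cases hs : s
  · simp [hs]
  · simp [hs]

/-- **(κ-b) DEEP — TWO PURE CELLS WITH THE SAME LABEL AND PROPORTIONAL WEIGHTS.**  Cells `D, K` with weights `f_D, f_K` and labels `(P_D, Q_D)`, `(P_K, Q_K)`; if ONE proposition `s`
labels every weighted member of BOTH (`P ↔ s`, `Q ↔ ¬s`) and the weighted sizes satisfy `Σᶠ_K f_K = c·Σᶠ_D f_D` in `ℤ`, then `cellDiff(K) = c·cellDiff(D)`: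
`(Σᶠ_{K ∩ P_K} f_K − Σᶠ_{K ∩ Q_K} f_K) = c·(Σᶠ_{D ∩ P_D} f_D − Σᶠ_{D ∩ Q_D} f_D)`.  (RamM near cell against the diagonal cell: `c = q − 1` by ★ p861491; the same `s` by ★ p861810.)
[cite: Kottwitz1986BaseChangeUnits, §1 pp. 240–241] [cite: Rogawski1990, §4.9 Prop. 4.9.1 (b) p. 55] [cite: LanglandsShelstad1987, §1–§3] -/
theorem cellDiff_eq_mul_cellDiff_of_same_labels (D K : Set ι) (fD fK : ι → ℕ) (PD QD PK QK : ι → Prop) (s : Prop) (c : ℤ)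
    (hD : ∀ Λ ∈ D, fD Λ ≠ 0 → (PD Λ ↔ s) ∧ (QD Λ ↔ ¬ s)) (hK : ∀ Λ ∈ K, fK Λ ≠ 0 → (PK Λ ↔ s) ∧ (QK Λ ↔ ¬ s))
    (hsize : ((∑ᶠ Λ ∈ K, fK Λ : ℕ) : ℤ) = c * ((∑ᶠ Λ ∈ D, fD Λ : ℕ) : ℤ)) :
    ((∑ᶠ Λ ∈ K ∩ {Λ | PK Λ}, fK Λ : ℕ) : ℤ) - ((∑ᶠ Λ ∈ K ∩ {Λ | QK Λ}, fK Λ : ℕ) : ℤ) =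
      c * (((∑ᶠ Λ ∈ D ∩ {Λ | PD Λ}, fD Λ : ℕ) : ℤ) - ((∑ᶠ Λ ∈ D ∩ {Λ | QD Λ}, fD Λ : ℕ) : ℤ)) := by
  classical
  rw [cellDiff_eq_ite_of_label K fK PK QK s hK, cellDiff_eq_ite_of_label D fD PD QD s hD, hsize]
  by_cases hs : s
  · simp [hs]
  · simp [hs]

/-- **(κ-b) AT `δ = 2d` — TWO PURE CELLS WITH OPPOSITE LABELS AND PROPORTIONAL WEIGHTS.**  As above but `K` is labelled by `¬s` (`P_K ↔ ¬s`, `Q_K ↔ s`): then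
`cellDiff(K) = −(c·cellDiff(D))`.  (`c = 1` and equal weights: ★ p861637's sibling `cellDiff_eq_neg_cellDiff_of_opposite_labels`, the cross-literal (L-D×).)
[cite: Kottwitz1986BaseChangeUnits, §1 pp. 240–241] [cite: Rogawski1990, §4.9 Prop. 4.9.1 (b) p. 55] [cite: LanglandsShelstad1987, §1–§3] -/
theorem cellDiff_eq_neg_mul_cellDiff_of_opposite_labels (D K : Set ι) (fD fK : ι → ℕ) (PD QD PK QK : ι → Prop) (s : Prop) (c : ℤ)
    (hD : ∀ Λ ∈ D, fD Λ ≠ 0 → (PD Λ ↔ s) ∧ (QD Λ ↔ ¬ s)) (hK : ∀ Λ ∈ K, fK Λ ≠ 0 → (PK Λ ↔ ¬ s) ∧ (QK Λ ↔ s))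
    (hsize : ((∑ᶠ Λ ∈ K, fK Λ : ℕ) : ℤ) = c * ((∑ᶠ Λ ∈ D, fD Λ : ℕ) : ℤ)) :
    ((∑ᶠ Λ ∈ K ∩ {Λ | PK Λ}, fK Λ : ℕ) : ℤ) - ((∑ᶠ Λ ∈ K ∩ {Λ | QK Λ}, fK Λ : ℕ) : ℤ) =
      -(c * (((∑ᶠ Λ ∈ D ∩ {Λ | PD Λ}, fD Λ : ℕ) : ℤ) - ((∑ᶠ Λ ∈ D ∩ {Λ | QD Λ}, fD Λ : ℕ) : ℤ))) := by
  classical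
  have hK' : ∀ Λ ∈ K, fK Λ ≠ 0 → (PK Λ ↔ ¬ s) ∧ (QK Λ ↔ ¬ ¬ s) := fun Λ hΛ hf =>
    ⟨(hK Λ hΛ hf).1, (hK Λ hΛ hf).2.trans not_not.symm⟩
  rw [cellDiff_eq_ite_of_label K fK PK QK (¬ s) hK', cellDiff_eq_ite_of_label D fD PD QD s hD, hsize]
  by_cases hs : s
  · simp [hs]
  · simp [hs]

/-- **THE TWO-CELL SUBTOTAL, SAME LABELS**: under the hypotheses of `cellDiff_eq_mul_cellDiff_of_same_labels`, `cellDiff(K) + cellDiff(D) = (c + 1)·cellDiff(D)` — the line (L-Σ)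
adds for the pair `(K₀, D)` in the deep regime. [cite: Kottwitz1986BaseChangeUnits, §1 pp. 240–241] [cite: Rogawski1990, §4.9 Prop. 4.9.1 (b) p. 55] -/
theorem cellDiff_add_cellDiff_of_same_labels (D K : Set ι) (fD fK : ι → ℕ) (PD QD PK QK : ι → Prop) (s : Prop) (c : ℤ)
    (hD : ∀ Λ ∈ D, fD Λ ≠ 0 → (PD Λ ↔ s) ∧ (QD Λ ↔ ¬ s)) (hK : ∀ Λ ∈ K, fK Λ ≠ 0 → (PK Λ ↔ s) ∧ (QK Λ ↔ ¬ s))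
    (hsize : ((∑ᶠ Λ ∈ K, fK Λ : ℕ) : ℤ) = c * ((∑ᶠ Λ ∈ D, fD Λ : ℕ) : ℤ)) :
    (((∑ᶠ Λ ∈ K ∩ {Λ | PK Λ}, fK Λ : ℕ) : ℤ) - ((∑ᶠ Λ ∈ K ∩ {Λ | QK Λ}, fK Λ : ℕ) : ℤ)) +
        (((∑ᶠ Λ ∈ D ∩ {Λ | PD Λ}, fD Λ : ℕ) : ℤ) - ((∑ᶠ Λ ∈ D ∩ {Λ | QD Λ}, fD Λ : ℕ) : ℤ)) =
      (c + 1) * (((∑ᶠ Λ ∈ D ∩ {Λ | PD Λ}, fD Λ : ℕ) : ℤ) - ((∑ᶠ Λ ∈ D ∩ {Λ | QD Λ}, fD Λ : ℕ) : ℤ)) := by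
  rw [cellDiff_eq_mul_cellDiff_of_same_labels D K fD fK PD QD PK QK s c hD hK hsize]
  ring

/-- **THE TWO-CELL SUBTOTAL, OPPOSITE LABELS**: under the hypotheses of `cellDiff_eq_neg_mul_cellDiff_of_opposite_labels`, `cellDiff(K) + cellDiff(D) = (1 − c)·cellDiff(D)` — at
`c = 1` (RamM with `q = 2`: `#K₀ = (q − 1)q^{j−1} = #D`-weight) the pair `(K₀, D)` CANCELS in (L-Σ). [cite: Kottwitz1986BaseChangeUnits, §1 pp. 240–241] [cite: Rogawski1990, §4.9 Prop. 4.9.1 (b) p. 55] -/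
theorem cellDiff_add_cellDiff_of_opposite_labels (D K : Set ι) (fD fK : ι → ℕ) (PD QD PK QK : ι → Prop) (s : Prop) (c : ℤ)
    (hD : ∀ Λ ∈ D, fD Λ ≠ 0 → (PD Λ ↔ s) ∧ (QD Λ ↔ ¬ s)) (hK : ∀ Λ ∈ K, fK Λ ≠ 0 → (PK Λ ↔ ¬ s) ∧ (QK Λ ↔ s))
    (hsize : ((∑ᶠ Λ ∈ K, fK Λ : ℕ) : ℤ) = c * ((∑ᶠ Λ ∈ D, fD Λ : ℕ) : ℤ)) :
    (((∑ᶠ Λ ∈ K ∩ {Λ | PK Λ}, fK Λ : ℕ) : ℤ) - ((∑ᶠ Λ ∈ K ∩ {Λ | QK Λ}, fK Λ : ℕ) : ℤ)) +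
        (((∑ᶠ Λ ∈ D ∩ {Λ | PD Λ}, fD Λ : ℕ) : ℤ) - ((∑ᶠ Λ ∈ D ∩ {Λ | QD Λ}, fD Λ : ℕ) : ℤ)) =
      (1 - c) * (((∑ᶠ Λ ∈ D ∩ {Λ | PD Λ}, fD Λ : ℕ) : ℤ) - ((∑ᶠ Λ ∈ D ∩ {Λ | QD Λ}, fD Λ : ℕ) : ℤ)) := by
  rw [cellDiff_eq_neg_mul_cellDiff_of_opposite_labels D K fD fK PD QD PK QK s c hD hK hsize]
  ring

end Summit.HodgeConjecture.HodgeConjecture.Cruxes.H413.F0P3cDyRamNearCellLedger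

end
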